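import Summits.QuantumFields.YangMills.Theorems.GronwallGapContinuumFromLatticeGapDecayOfRPSpectralLocal
import Summits.QuantumFields.YangMills.Theorems.LangevinControlUVOSLegsFromFemtoAndGapStubCollar6
import Literature.MathematicalPhysics.QuantumFieldTheory.QCDTorusTranslation
import Summits.QuantumFields.YangMills.Theorems.LangevinControlUVOSLegsAtWeakCouplingCStubRopeAnchor
import HarnessLib

/-!
# `ContinuumFromLatticeGap` (stmt-QuantumFields-15915), line `registered`, reshape 6: the monomial expansion of the
# shifted smeared plane-string functional

Support file for the crux item stmt-QuantumFields-15915 (`GronwallGap.ContinuumFromLatticeGap`), reshape 6 of line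
`registered` (the RP-spectral conjunct (b) eliminated).  The new decay leg bounds the far value of the reflected diagonal
correlation of the decay leg's OWN functional `Y_k` by Minkowski over its expansion into plaquette MONOMIALS; this file is
the bookkeeping of that expansion for the shifted functional `F := Y ∘ configShift e₀` (supported at times `≥ 0`, the
convention of the landed RP core):

* `shifted_eq_sum` — `F V = Σ_{(q, y, s)} Re(F_c(a y)) · ∏_{l ∉ s}(−μ) · ∏_{l ∈ s} plane (q l) (y l − e₀) V`, the sum over
  valid orientation strings `q`, site strings `y` in the GOOD box (`1 ≤ y_l⁰`, `y_l⁰ + 1 ≤ d`, `|y_lⁱ| ≤ d`) and subsets `s`;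
* `monomial_facts` — each monomial is a bounded measurable cylinder observable supported on links based at times
  `0 ≤ x₀ ≤ d`, with sites in the box of size `d'` for every `d' ≥ d`;
* `shifted_isCylinder` — `F` is a cylinder observable on the explicit finite edge box, based at times `0 ≤ x₀ ≤ d`;
* `sum_abs_coeff_le` — the `ℓ¹` norm of the coefficients.

No definitions, no named facts.  Refs: OsterwalderSeiler1978 §2; GlimmJaffe1987 §6.1.
-/

noncomputable section

open scoped SchwartzMap BigOperators ComplexConjugate
open MeasureTheory Filter Topology
open Literature.MathematicalPhysics.QuantumFieldTheory Literature.MathematicalPhysics.QuantumLattice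
open Literature.MathematicalPhysics.AQFT
open Literature.Probability.LatticeModels (box Site mem_box)
open Summit.QuantumFields.YangMills.Cruxes.OSLegsFromFemtoAndGap.DlrCollarTransfer
open Summit.QuantumFields.YangMills.Theorems.WeakCouplingHypercubicLimit.TraceNormColdPressure (measurable_plane)

namespace Summit.QuantumFields.YangMills.Theorems.ContinuumFromLatticeGap

variable {G : Type} [Group G] [TopologicalSpace G] [IsTopologicalGroup G] [CompactSpace G]
  [MeasurableSpace G] [BorelSpace G]

/-! ## The monomials -/

omit [IsTopologicalGroup G] [CompactSpace G] [BorelSpace G] in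
/-- Translating the configuration by `e₀` moves the site of a plane field by `−e₀`. [folklore] -/
theorem plane_configShift_single (r : LatticeRep G) (q : Fin 4 × Fin 4) (x : Site 4) (V : LGConfig 4 G) :
    plane G r q x (configShift (Pi.single 0 1) V) = plane G r q (x - Pi.single 0 1) V := by
  unfold plane
  rw [← configShift_add']
  congr 2
  abel

/-- **Facts about one monomial.**  For orientations `q`, sites `z` with `0 ≤ z_l⁰`, `z_l⁰ + 1 ≤ d` and a subset `s`, the
monomial `∏_{l ∈ s} plane (q l) (z l)` is measurable, bounded, and a cylinder observable on the union of the translated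
origin plaquette supports, all of whose links are based at times `0 ≤ x₀ ≤ d`. [folklore] -/
theorem monomial_facts (r : LatticeRep G) {n : ℕ} (q : Fin n → Fin 4 × Fin 4) (z : Fin n → Site 4) (s : Finset (Fin n))
    (d : ℕ) (hz : ∀ l, 0 ≤ z l 0 ∧ z l 0 + 1 ≤ (d : ℤ)) :
    Measurable (fun V : LGConfig 4 G => ∏ l ∈ s, plane G r (q l) (z l) V) ∧
    (∃ C : ℝ, ∀ V : LGConfig 4 G, |∏ l ∈ s, plane G r (q l) (z l) V| ≤ C) ∧
    IsCylinder (fun V : LGConfig 4 G => ∏ l ∈ s, plane G r (q l) (z l) V)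
      (s.biUnion fun l => (originPlaquetteSupport (q l).1 (q l).2).image fun e => (e.1 - -(z l), e.2)) ∧
    (∀ e ∈ s.biUnion fun l => (originPlaquetteSupport (q l).1 (q l).2).image fun e => (e.1 - -(z l), e.2),
      0 ≤ e.1 0 ∧ e.1 0 ≤ (d : ℤ)) := by
  obtain ⟨Cp, hCp⟩ := exists_abs_plane_le (G := G) r
  refine ⟨Finset.measurable_prod _ fun l _ => measurable_plane r (q l) (z l), ⟨∏ _l ∈ s, Cp, fun V => ?_⟩,
    fun U V hUV => ?_, fun e he => ?_⟩
  · rw [Finset.abs_prod]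
    exact Finset.prod_le_prod (fun _ _ => abs_nonneg _) fun l _ => hCp _ _ _
  · exact Finset.prod_congr rfl fun l hl => isCylinder_plane r (q l) (z l)
      (fun e he => hUV e (Finset.mem_coe.2 (Finset.mem_biUnion.2 ⟨l, hl, Finset.mem_coe.1 he⟩)))
  · obtain ⟨l, -, hel⟩ := Finset.mem_biUnion.1 he
    have h := near_of_mem_supp_plane hel 0
    obtain ⟨h0, h1⟩ := hz l
    constructor <;> omega

/-! ## The shifted functional as a finite combination of monomials -/

omit [IsTopologicalGroup G] [CompactSpace G] [BorelSpace G] in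
/-- **Expansion of the shifted functional.**  If `F_c(a y) ≠ 0` forces every site into the good box (`1 ≤ y_l⁰`,
`y_l⁰ + 1 ≤ d`, `|y_lⁱ| + 1 ≤ d`, with `d ≤ L`), then the real smeared plane-string functional read on the configuration
translated by `e₀` is the finite real combination
`Σ_{(q,y,s)} Re(F_c(a y)) ∏_{l∉s}(−μ) ∏_{l∈s} plane (q l) (y l − e₀)` over valid `q`, good `y`, all `s`. [folklore] -/
theorem shifted_eq_sum (r : LatticeRep G) (L : ℕ) (a : ℝ) {n : ℕ} (Fc : 𝓢((Fin n → EuclideanSpace ℝ (Fin 4)), ℂ))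
    (μ : ℝ) (d : ℕ) (hdL : d ≤ L)
    (hgood : ∀ y : Fin n → Site 4, Fc (fun l => a • siteToE (y l)) ≠ 0 →
      ∀ l, (1 ≤ y l 0 ∧ y l 0 + 1 ≤ (d : ℤ)) ∧ ∀ i : Fin 4, |y l i| + 1 ≤ (d : ℤ))
    (V : LGConfig 4 G) :
    (∑ q ∈ Fintype.piFinset (fun _ : Fin n => Finset.univ.filter fun p : Fin 4 × Fin 4 => p.1 < p.2),
        ∑ y ∈ Fintype.piFinset (fun _ : Fin n => box 4 L),
          Fc (fun l => a • siteToE (y l)) *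
            ((∏ l, (plane G r (q l) (y l) (configShift (Pi.single 0 1) V) - μ) : ℝ) : ℂ)).re =
      ∑ i ∈ (Fintype.piFinset fun _ : Fin n => Finset.univ.filter fun p : Fin 4 × Fin 4 => p.1 < p.2) ×ˢ
          ((Fintype.piFinset fun _ : Fin n =>
              (Fintype.piFinset fun _ : Fin 4 => Finset.Icc (-(d : ℤ)) d).filter
                fun y : Site 4 => 1 ≤ y 0 ∧ y 0 + 1 ≤ (d : ℤ)) ×ˢ
            (Finset.univ : Finset (Fin n)).powerset),
        (Fc (fun l => a • siteToE (i.2.1 l))).re * (∏ _l ∈ Finset.univ \ i.2.2, (-μ)) *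
          ∏ l ∈ i.2.2, plane G r (i.1 l) (i.2.1 l - Pi.single 0 1) V := by
  classical
  set good : Finset (Site 4) := (Fintype.piFinset fun _ : Fin 4 => Finset.Icc (-(d : ℤ)) d).filter
    fun y : Site 4 => 1 ≤ y 0 ∧ y 0 + 1 ≤ (d : ℤ) with hgood_def
  -- the good box sits inside the torus box
  have hsub : Fintype.piFinset (fun _ : Fin n => good) ⊆ Fintype.piFinset (fun _ : Fin n => box 4 L) := by
    refine Fintype.piFinset_subset _ _ fun _ y hy => ?_
    rw [hgood_def, Finset.mem_filter, Fintype.mem_piFinset] at hy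
    rw [mem_box]
    intro i
    have h := Finset.mem_Icc.1 (hy.1 i)
    constructor <;> omega
  -- sites with a non-zero coefficient are good
  have hvan : ∀ y ∈ Fintype.piFinset (fun _ : Fin n => box 4 L), y ∉ Fintype.piFinset (fun _ : Fin n => good) →
      Fc (fun l => a • siteToE (y l)) = 0 := by
    intro y _ hy
    by_contra h
    apply hy
    rw [Fintype.mem_piFinset]
    intro l
    obtain ⟨⟨h1, h2⟩, h3⟩ := hgood y h l
    rw [hgood_def, Finset.mem_filter, Fintype.mem_piFinset]
    refine ⟨fun i => Finset.mem_Icc.2 ?_, h1, h2⟩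
    have := h3 i
    constructor
    · linarith [neg_abs_le (y l i)]
    · linarith [le_abs_self (y l i)]
  rw [Complex.re_sum, Finset.sum_product]
  refine Finset.sum_congr rfl fun q _ => ?_
  rw [Complex.re_sum, Finset.sum_product]
  rw [← Finset.sum_subset hsub (fun y hy hy' => by rw [hvan y hy hy', zero_mul, Complex.zero_re])]
  refine Finset.sum_congr rfl fun y _ => ?_
  -- one site string: real part, shift of the sites, expansion over subsets
  rw [Complex.re_mul_ofReal]
  have hshift : ∏ l, (plane G r (q l) (y l) (configShift (Pi.single 0 1) V) - μ) =
      ∏ l, (plane G r (q l) (y l - Pi.single 0 1) V + -μ) :=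
    Finset.prod_congr rfl fun l _ => by rw [plane_configShift_single, sub_eq_add_neg]
  rw [hshift, Finset.prod_add, Finset.mul_sum]
  refine Finset.sum_congr rfl fun s _ => ?_
  ring

/-! ## The shifted functional is a positive-time cylinder observable -/

omit [Group G] [TopologicalSpace G] [IsTopologicalGroup G] [CompactSpace G] [BorelSpace G] in
/-- **Cylinder property of the shifted functional.**  A functional depending only on the slab-box edges
`{1 ≤ e⁰, e⁰ + [μ=0] ≤ d, |eⁱ| ≤ d (i ≠ 0)}`, read on the configuration translated by `e₀`, is a cylinder observable
on the finite edge box `[0, d] × [−d, d]³` (all orientations), whose links are based at times `0 ≤ x₀ ≤ d`. [folklore] -/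
theorem shifted_isCylinder {Y : LGConfig 4 G → ℝ} {d : ℕ}
    (hY : DependsOn Y {e : Literature.MathematicalPhysics.QuantumLattice.ZdEdge 4 |
      (1 ≤ e.1 0 ∧ e.1 0 + (if e.2 = 0 then 1 else 0) ≤ (d : ℤ)) ∧ ∀ i : Fin 4, i ≠ 0 → |e.1 i| ≤ (d : ℤ)}) :
    IsCylinder (fun V : LGConfig 4 G => Y (configShift (Pi.single 0 1) V))
      (((Fintype.piFinset fun _ : Fin 4 => Finset.Icc (-(d : ℤ)) d) ×ˢ (Finset.univ : Finset (Fin 4))).filter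
        fun e : Literature.MathematicalPhysics.QuantumLattice.ZdEdge 4 => 0 ≤ e.1 0) ∧
    (∀ e ∈ ((Fintype.piFinset fun _ : Fin 4 => Finset.Icc (-(d : ℤ)) d) ×ˢ (Finset.univ : Finset (Fin 4))).filter
        fun e : Literature.MathematicalPhysics.QuantumLattice.ZdEdge 4 => 0 ≤ e.1 0,
      0 ≤ e.1 0 ∧ e.1 0 ≤ (d : ℤ)) := by
  classical
  refine ⟨fun U V hUV => hY fun e he => ?_, fun e he => ?_⟩
  · simp only [configShift_apply]
    obtain ⟨⟨h1, h2⟩, h3⟩ := he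
    have hite : (0 : ℤ) ≤ (if e.2 = 0 then 1 else 0) := by split_ifs <;> norm_num
    refine hUV (e.1 - Pi.single 0 1, e.2) (Finset.mem_coe.2 (Finset.mem_filter.2 ⟨Finset.mem_product.2
      ⟨Fintype.mem_piFinset.2 fun i => Finset.mem_Icc.2 ?_, Finset.mem_univ _⟩, ?_⟩))
    · by_cases hi : i = 0
      · subst hi
        simp only [Pi.sub_apply, Pi.single_eq_same]
        constructor <;> omega
      · simp only [Pi.sub_apply, Pi.single_eq_of_ne hi, sub_zero]
        have h := h3 i hi
        exact ⟨by linarith [neg_abs_le (e.1 i)], by linarith [le_abs_self (e.1 i)]⟩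
    · simp only [Pi.sub_apply, Pi.single_eq_same]
      omega
  · rw [Finset.mem_filter, Finset.mem_product, Fintype.mem_piFinset] at he
    exact ⟨he.2, (Finset.mem_Icc.1 (he.1.1 0)).2⟩

/-! ## Geometry of good site strings -/

/-- A good site string shifted by `−e₀` has times in `[0, d − 2]` and sits in every box of size `d' ≥ d` (the format of
the UNIFORM-monomial hypothesis of the line). [folklore] -/
theorem good_shift_box {n : ℕ} {d d' : ℕ} (hdd' : d ≤ d') {y : Fin n → Site 4}
    (hy : y ∈ Fintype.piFinset fun _ : Fin n =>
      (Fintype.piFinset fun _ : Fin 4 => Finset.Icc (-(d : ℤ)) d).filter fun y : Site 4 => 1 ≤ y 0 ∧ y 0 + 1 ≤ (d : ℤ)) :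
    (∀ l, 0 ≤ (y l - (Pi.single 0 1 : Site 4)) 0 ∧ (y l - (Pi.single 0 1 : Site 4)) 0 + 1 ≤ (d : ℤ)) ∧
    (∀ l, (0 ≤ (y l - (Pi.single 0 1 : Site 4)) 0 ∧ (y l - (Pi.single 0 1 : Site 4)) 0 ≤ (d' : ℤ)) ∧
      ∀ i : Fin 4, i ≠ 0 → |(y l - (Pi.single 0 1 : Site 4)) i| ≤ (d' : ℤ)) := by
  rw [Fintype.mem_piFinset] at hy
  have hl : ∀ l, (∀ i, -(d : ℤ) ≤ y l i ∧ y l i ≤ d) ∧ 1 ≤ y l 0 ∧ y l 0 + 1 ≤ (d : ℤ) := fun l => by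
    have h := hy l
    rw [Finset.mem_filter, Fintype.mem_piFinset] at h
    exact ⟨fun i => Finset.mem_Icc.1 (h.1 i), h.2.1, h.2.2⟩
  have hdd : (d : ℤ) ≤ d' := by exact_mod_cast hdd'
  refine ⟨fun l => ?_, fun l => ⟨?_, fun i hi => ?_⟩⟩
  · obtain ⟨-, h1, h2⟩ := hl l
    simp only [Pi.sub_apply, Pi.single_eq_same]
    constructor <;> omega
  · obtain ⟨-, h1, h2⟩ := hl l
    simp only [Pi.sub_apply, Pi.single_eq_same]
    constructor <;> omega
  · obtain ⟨hb, -, -⟩ := hl l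
    simp only [Pi.sub_apply, Pi.single_eq_of_ne hi, sub_zero]
    exact (abs_le.2 (hb i)).trans hdd

/-! ## The `ℓ¹` norm of the coefficients -/

/-- **Coefficient bound**: `Σ_{(q,y,s)} |Re(F_c(a y)) ∏_{l∉s}(−μ)| ≤ 6ⁿ · 2ⁿ · (max 1 |μ|)ⁿ · Σ_{y good} ‖F_c(a y)‖`
(`sum_idx_eq` of the rope anchor counts the subsets). [folklore] -/
theorem sum_abs_coeff_le (a : ℝ) {n : ℕ} (Fc : 𝓢((Fin n → EuclideanSpace ℝ (Fin 4)), ℂ)) (μ : ℝ)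
    (Ygood : Finset (Fin n → Site 4)) :
    ∑ i ∈ (Fintype.piFinset fun _ : Fin n => Finset.univ.filter fun p : Fin 4 × Fin 4 => p.1 < p.2) ×ˢ
          (Ygood ×ˢ (Finset.univ : Finset (Fin n)).powerset),
        |(Fc (fun l => a • siteToE (i.2.1 l))).re * ∏ _l ∈ Finset.univ \ i.2.2, (-μ)| ≤
      6 ^ n * 2 ^ n * max 1 |μ| ^ n * ∑ y ∈ Ygood, ‖Fc (fun l => a • siteToE (y l))‖ := by
  classical
  have hcardP : ((Fintype.piFinset fun _ : Fin n => Finset.univ.filter fun p : Fin 4 × Fin 4 => p.1 < p.2).card : ℝ) =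
      6 ^ n := by
    rw [Fintype.card_piFinset_const]; push_cast; congr 1
  -- each term
  have hterm : ∀ (y : Fin n → Site 4) (s : Finset (Fin n)),
      |(Fc (fun l => a • siteToE (y l))).re * ∏ _l ∈ Finset.univ \ s, (-μ)| ≤
        max 1 |μ| ^ n * ‖Fc (fun l => a • siteToE (y l))‖ := by
    intro y s
    rw [abs_mul, Finset.abs_prod, mul_comm]
    refine mul_le_mul ?_ (Complex.abs_re_le_norm _) (abs_nonneg _) (by positivity)
    simp only [abs_neg, Finset.prod_const]
    calc |μ| ^ (Finset.univ \ s).card ≤ max 1 |μ| ^ (Finset.univ \ s).card :=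
          pow_le_pow_left₀ (abs_nonneg _) (le_max_right _ _) _
      _ ≤ max 1 |μ| ^ n := by
          refine pow_le_pow_right₀ (le_max_left _ _) ?_
          exact (Finset.card_le_univ _).trans (by rw [Fintype.card_fin])
  calc ∑ i ∈ (Fintype.piFinset fun _ : Fin n => Finset.univ.filter fun p : Fin 4 × Fin 4 => p.1 < p.2) ×ˢ
          (Ygood ×ˢ (Finset.univ : Finset (Fin n)).powerset),
        |(Fc (fun l => a • siteToE (i.2.1 l))).re * ∏ _l ∈ Finset.univ \ i.2.2, (-μ)|
      ≤ ∑ i ∈ (Fintype.piFinset fun _ : Fin n => Finset.univ.filter fun p : Fin 4 × Fin 4 => p.1 < p.2) ×ˢ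
          (Ygood ×ˢ (Finset.univ : Finset (Fin n)).powerset),
          max 1 |μ| ^ n * ‖Fc (fun l => a • siteToE (i.2.1 l))‖ := Finset.sum_le_sum fun i _ => hterm _ _
    _ = 2 ^ n * ∑ _q ∈ (Fintype.piFinset fun _ : Fin n => Finset.univ.filter fun p : Fin 4 × Fin 4 => p.1 < p.2),
          ∑ y ∈ Ygood, max 1 |μ| ^ n * ‖Fc (fun l => a • siteToE (y l))‖ :=
        Summit.QuantumFields.YangMills.Theorems.OSLegsAtWeakCouplingC.Anchor.sum_idx_eq _ _
          (fun y => max 1 |μ| ^ n * ‖Fc (fun l => a • siteToE (y l))‖)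
    _ = 6 ^ n * 2 ^ n * max 1 |μ| ^ n * ∑ y ∈ Ygood, ‖Fc (fun l => a • siteToE (y l))‖ := by
        rw [Finset.sum_const, nsmul_eq_mul, hcardP, ← Finset.mul_sum]
        ring

/-- **Registered sub-goal `stub_shiftedExpansion`** (line `registered`, reshape 6): the expansion of the shifted smeared
plane-string functional into plaquette monomials, in closed form (`shifted_eq_sum`). [folklore] -/
theorem stub_shiftedExpansion :
    ∀ (G : Type) [Group G] [TopologicalSpace G] [MeasurableSpace G] (r : LatticeRep G) (L : ℕ) (a : ℝ) (n : ℕ)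
      (Fc : 𝓢((Fin n → EuclideanSpace ℝ (Fin 4)), ℂ)) (μ : ℝ) (d : ℕ), d ≤ L →
      (∀ y : Fin n → Site 4, Fc (fun l => a • siteToE (y l)) ≠ 0 →
        ∀ l, (1 ≤ y l 0 ∧ y l 0 + 1 ≤ (d : ℤ)) ∧ ∀ i : Fin 4, |y l i| + 1 ≤ (d : ℤ)) →
      ∀ V : LGConfig 4 G,
        (∑ q ∈ Fintype.piFinset (fun _ : Fin n => Finset.univ.filter fun p : Fin 4 × Fin 4 => p.1 < p.2),
            ∑ y ∈ Fintype.piFinset (fun _ : Fin n => box 4 L),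
              Fc (fun l => a • siteToE (y l)) *
                ((∏ l, (plane G r (q l) (y l) (configShift (Pi.single 0 1) V) - μ) : ℝ) : ℂ)).re =
          ∑ i ∈ (Fintype.piFinset fun _ : Fin n => Finset.univ.filter fun p : Fin 4 × Fin 4 => p.1 < p.2) ×ˢ
              ((Fintype.piFinset fun _ : Fin n =>
                  (Fintype.piFinset fun _ : Fin 4 => Finset.Icc (-(d : ℤ)) d).filter
                    fun y : Site 4 => 1 ≤ y 0 ∧ y 0 + 1 ≤ (d : ℤ)) ×ˢ
                (Finset.univ : Finset (Fin n)).powerset),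
            (Fc (fun l => a • siteToE (i.2.1 l))).re * (∏ _l ∈ Finset.univ \ i.2.2, (-μ)) *
              ∏ l ∈ i.2.2, plane G r (i.1 l) (i.2.1 l - Pi.single 0 1) V :=
  fun _ _ _ _ r L a _ Fc μ d hdL hgood V => shifted_eq_sum r L a Fc μ d hdL hgood V

end Summit.QuantumFields.YangMills.Theorems.ContinuumFromLatticeGap

end
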